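import Summits.HubbardSuperconductivity.HubbardSuperconductivity.Theses.ChiralWindow
import Summits.HubbardSuperconductivity.HubbardSuperconductivity.Theorems.AposterioriCapRgSsbToEvenTorusLroFacePurityOfGcRepelledChord
import Summits.HubbardSuperconductivity.HubbardSuperconductivity.Theorems.ChiralWindowCwSsbToEvenTorusLROAttractiveChordFloor
import HarnessLib

/-!
# Crux `CwSsbToEvenTorusLRO` (stmt-HubbardSuperconductivity-10439, route `ChiralWindow`), line `griffiths-block-slope` —
the DICHOTOMY glue: with the landed attractive chord floor (S6), the crux's thermodynamic half on this line is
"the Kac block slope does not COLLAPSE across `κ = 0`"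

Notation (docstrings): `K_μ = hubbardTorusWith 2 L 1 U μ` (source-free grand-canonical torus), `W_R = R⁻⁴ Σ_a B_aᴴ B_a`
(`B_a = Σ_{u ∈ [0,R)²} P_{a+u}`, `P_y = localPair dWaveFormFactor L y`), `g(κ) = E₀(K_μ + κ W_R)` (`E₀ = Matrix.groundEnergy`;
concave in `κ`), `m = dWaveOrderParameter U μ`. The line's open core S2' (= the sibling lead's GRC) is the RIGHT chord floor
`g(κ) − g(0) ≥ κ a L²` (∀R ∃κ(R), eventually along even sides). The landed S6
`CwSsbToEvenTorusLRO.stub_attractiveChordFloor` (p99547) is the LEFT chord floor `g(0) − g(−t) ≥ t(m² − ε)L²` for every `t ≥ 0`: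
Koma–Tasaki order forces the attractive block slope to be `≥ m²`. Hence (this file, sorry-free):

* `slopeFloor_of_noCollapseAt` — if the right chord keeps a fraction `θ > 0` of the left chord at some `κ(R) > 0`
  (eventually in the side), every `R`, then S2' holds with `a = θ m²/2`;
* `slopeFloor_of_noBlockKinkAt` — if `g` has NO KINK at `0` for every `R` in the card's/adversary's encoding
  (`∀ ε > 0, ∃ κ > 0`, eventually: `g(κ) + g(−κ) − 2g(0) ≥ −εκL²`; cf. the landed `Negative/BlockStubEncoding.noBlockKinkAt_of_limit`,
  same spelling with `dWaveSourceTorus (L+1) U μ 0 = K_μ`), then S2' holds with `a = m²/2` — so Transfer A of the original card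
  (no kink) ALSO closes the crux on this line, and S2' is weaker than both transfers (B: `gcRepelledChord_of_repelledOrderAt`);
* `cwSsbToEvenTorusLRO_of_noBlockKink` (REGISTERED composition obligation), `cwSsbToEvenTorusLRO_of_noSlopeCollapse` — the crux BY NAME
  from the guarded no-kink (resp. no-collapse) statement and item stmt-1089 `KacWindowPenalty.WindowInfraredBound` BY NAME, through
  the sibling lead's landed `fp_chord_of_gcRepelledChordAt` and the twin's landed dissection/Fejér closure (CONDITIONAL glue).

The kill configuration of all of them is one and the same (Disproof §3/§6d, `transferB_fails_at_scNormal_coexistence`): an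
iso-`μ`, equal-energy-density coexistence of the `d`-wave phase with a block-poorer phase — there the left slope stays `≥ m²`
(S6 is a theorem) while the right chord collapses. [folklore] bookkeeping; no definition is introduced.
-/

noncomputable section

set_option linter.dupNamespace false

namespace Summit.HubbardSuperconductivity.HubbardSuperconductivity.Theorems.CwSsbToEvenTorusLRO

open Literature.MathematicalPhysics.QuantumLattice Literature.Barriers.HubbardSuperconductivity
open Summit.HubbardSuperconductivity.WcbcsSsbToTorusLRO.Negative
open Summit.HubbardSuperconductivity.HubbardSuperconductivity.Theorems (fp_chord_of_gcRepelledChordAt)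
open Filter Set Matrix
open scoped Matrix ComplexOrder BigOperators
open _root_.Topology

/-- **No collapse of the block slope ⇒ S2'** (pointwise in `(U, μ)`; floor `θ m²/2`): the right chord keeps the fraction
`θ` of the left chord, and the left chord is `≥ κ(m² − m²/2)L²` by the landed S6. [folklore] -/
theorem slopeFloor_of_noCollapseAt {U μ : ℝ} (hord : HasDWaveOrder U μ)
    (hNC : ∃ θ : ℝ, 0 < θ ∧ ∀ R : ℕ, 0 < R → ∃ κ : ℝ, 0 < κ ∧ ∀ᶠ L : ℕ in Filter.atTop, θ * ((hubbardTorusWith 2 (L + 1) 1 U μ).groundEnergy - (hubbardTorusWith 2 (L + 1) 1 U μ + ((-κ : ℝ) : ℂ) • (((((R : ℝ) ^ 4)⁻¹ : ℝ) : ℂ) • ∑ a : Literature.Probability.LatticeModels.TorusSite 2 (L + 1), (∑ u : Fin 2 → Fin R, localPair dWaveFormFactor (L + 1) (a + fun i => ((u i : ℕ) : ZMod (L + 1))))ᴴ * (∑ u : Fin 2 → Fin R, localPair dWaveFormFactor (L + 1) (a + fun i => ((u i : ℕ) : ZMod (L + 1)))))).groundEnergy) ≤ (hubbardTorusWith 2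 (L + 1) 1 U μ + (κ : ℂ) • (((((R : ℝ) ^ 4)⁻¹ : ℝ) : ℂ) • ∑ a : Literature.Probability.LatticeModels.TorusSite 2 (L + 1), (∑ u : Fin 2 → Fin R, localPair dWaveFormFactor (L + 1) (a + fun i => ((u i : ℕ) : ZMod (L + 1))))ᴴ * (∑ u : Fin 2 → Fin R, localPair dWaveFormFactor (L + 1) (a + fun i => ((u i : ℕ) : ZMod (L + 1)))))).groundEnergy - (hubbardTorusWith 2 (L + 1) 1 U μ).groundEnergy) :
    ∃ a : ℝ, 0 < a ∧ ∀ R : ℕ, 0 < R → ∃ κ : ℝ, 0 < κ ∧ ∀ᶠ k : ℕ in Filter.atTop, κ * a * ((2 * k + 1 + 1 : ℕ) : ℝ) ^ 2 ≤ (hubbardTorusWith 2 (2 * k + 1 + 1) 1 U μ + (κ : ℂ) • (((((R : ℝ) ^ 4)⁻¹ : ℝ) : ℂ) • ∑ a : Literature.Probability.LatticeModels.TorusSite 2 (2 * k + 1 + 1), (∑ u : Fin 2 → Fin R, localPair dWaveFormFactor (2 * k + 1 + 1) (a + fun i => ((u i : ℕ) : ZMod (2 * k + 1 + 1))))ᴴ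 * (∑ u : Fin 2 → Fin R, localPair dWaveFormFactor (2 * k + 1 + 1) (a + fun i => ((u i : ℕ) : ZMod (2 * k + 1 + 1)))))).groundEnergy - (hubbardTorusWith 2 (2 * k + 1 + 1) 1 U μ).groundEnergy := by
  obtain ⟨θ, hθ, hNC⟩ := hNC
  set m : ℝ := dWaveOrderParameter U μ with hm_def
  have hm : 0 < m := hord
  have h21 : Tendsto (fun k : ℕ => 2 * k + 1) atTop atTop := by
    refine tendsto_atTop_mono (fun k => ?_) tendsto_id
    simp only [id]; omega
  refine ⟨θ * m ^ 2 / 2, by positivity, fun R hR => ?_⟩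
  obtain ⟨κ, hκ, hL⟩ := hNC R hR
  refine ⟨κ, hκ, ?_⟩
  have hS6 := stub_attractiveChordFloor U μ R hR κ (m ^ 2 / 2) hκ.le (by positivity)
  have hboth := h21.eventually (hL.and hS6)
  filter_upwards [hboth] with k hk
  obtain ⟨hk1, hk2⟩ := hk
  rw [← hm_def] at hk2
  have hA : (0 : ℝ) < (((2 * k + 1 + 1 : ℕ) : ℝ)) ^ 2 := by positivity
  nlinarith [hk1, hk2, mul_le_mul_of_nonneg_left hk2 hθ.le]

/-- **No block kink ⇒ S2'** (pointwise in `(U, μ)`; floor `m²/2`): with the no-kink tolerance `ε := m²/4` the symmetric second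
difference costs at most `κ(m²/4)L²`, and the left chord is `≥ κ(3m²/4)L²` by the landed S6 — so the right chord is
`≥ κ(m²/2)L²`. [folklore] -/
theorem slopeFloor_of_noBlockKinkAt {U μ : ℝ} (hord : HasDWaveOrder U μ)
    (hNK : ∀ R : ℕ, 0 < R → ∀ ε : ℝ, 0 < ε → ∃ κ : ℝ, 0 < κ ∧ ∀ᶠ L : ℕ in Filter.atTop, -(ε * κ) * ((L + 1 : ℕ) : ℝ) ^ 2 ≤ (hubbardTorusWith 2 (L + 1) 1 U μ + (κ : ℂ) • (((((R : ℝ) ^ 4)⁻¹ : ℝ) : ℂ) • ∑ a : Literature.Probability.LatticeModels.TorusSite 2 (L + 1), (∑ u : Fin 2 → Fin R, localPair dWaveFormFactor (L + 1) (a + fun i => ((u i : ℕ) : ZMod (L + 1))))ᴴ * (∑ u : Fin 2 → Fin R, localPair dWaveFormFactor (L + 1) (a + fun i => ((u i : ℕ) : ZMod (L + 1)))))).groundEnergy + (hubbardTorusWith 2 (L + 1) 1 U μ + ((-κ : ℝ) : ℂ) • (((((R : ℝ) ^ 4)⁻¹ : ℝ) : ℂ) • ∑ a : Literature.Probability.LatticeModels.TorusSite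 2 (L + 1), (∑ u : Fin 2 → Fin R, localPair dWaveFormFactor (L + 1) (a + fun i => ((u i : ℕ) : ZMod (L + 1))))ᴴ * (∑ u : Fin 2 → Fin R, localPair dWaveFormFactor (L + 1) (a + fun i => ((u i : ℕ) : ZMod (L + 1)))))).groundEnergy - 2 * (hubbardTorusWith 2 (L + 1) 1 U μ).groundEnergy) :
    ∃ a : ℝ, 0 < a ∧ ∀ R : ℕ, 0 < R → ∃ κ : ℝ, 0 < κ ∧ ∀ᶠ k : ℕ in Filter.atTop, κ * a * ((2 * k + 1 + 1 : ℕ) : ℝ) ^ 2 ≤ (hubbardTorusWith 2 (2 * k + 1 + 1) 1 U μ + (κ : ℂ) • (((((R : ℝ) ^ 4)⁻¹ : ℝ) : ℂ) • ∑ a : Literature.Probability.LatticeModels.TorusSite 2 (2 * k + 1 + 1), (∑ u : Fin 2 → Fin R, localPair dWaveFormFactor (2 * k + 1 + 1) (a + fun i => ((u i : ℕ) : ZMod (2 * k + 1 + 1))))ᴴ * (∑ u : Fin 2 → Fin R, localPair dWaveFormFactor (2 * k + 1 + 1) (a + fun i => ((u i : ℕ) : ZMod (2 * k + 1 + 1)))))).groundEnergy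 - (hubbardTorusWith 2 (2 * k + 1 + 1) 1 U μ).groundEnergy := by
  set m : ℝ := dWaveOrderParameter U μ with hm_def
  have hm : 0 < m := hord
  have h21 : Tendsto (fun k : ℕ => 2 * k + 1) atTop atTop := by
    refine tendsto_atTop_mono (fun k => ?_) tendsto_id
    simp only [id]; omega
  refine ⟨m ^ 2 / 2, by positivity, fun R hR => ?_⟩
  obtain ⟨κ, hκ, hL⟩ := hNK R hR (m ^ 2 / 4) (by positivity)
  refine ⟨κ, hκ, ?_⟩
  have hS6 := stub_attractiveChordFloor U μ R hR κ (m ^ 2 / 4) hκ.le (by positivity)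
  have hboth := h21.eventually (hL.and hS6)
  filter_upwards [hboth] with k hk
  obtain ⟨hk1, hk2⟩ := hk
  rw [← hm_def] at hk2
  nlinarith [hk1, hk2]

/-- **The crux from NO BLOCK KINK (REGISTERED composition obligation; CONDITIONAL glue).** The guarded no-kink statement
(Transfer A of the card `griffiths-block-slope`, the block-slope-transport card's `NoBlockKink`) and item stmt-1089 BY NAME imply the crux
`ChiralWindow.CwSsbToEvenTorusLRO` BY NAME: no kink ⇒ S2' (`slopeFloor_of_noBlockKinkAt`, landed S6) ⇒ canonical chord
(`fp_chord_of_gcRepelledChordAt`, landed S3/S5) ⇒ derivative face purity (`deriv_of_chord`) ⇒ with the pointwise leak from stmt-1089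
(`leak_of_windowInfraredBound`) the floor (`floor_of_deriv_of_leak`, Fejér) ⇒ the summit matrix (`hasDWavePairFieldLROAt_of_floor`). [folklore] -/
theorem cwSsbToEvenTorusLRO_of_noBlockKink :
    (∃ U₀ : ℝ, 0 < U₀ ∧ ∀ U ∈ Set.Ioo (0:ℝ) U₀, ∀ δ ∈ Set.Ioo (0:ℝ) (1 / 2), ∀ μ : ℝ, Filter.Tendsto (fun L : ℕ => ((hubbardTorusWith 2 (L + 1) 1 U μ).groundStateFunctional totalNumber).re / ((L + 1 : ℕ) : ℝ) ^ 2) Filter.atTop (nhds (1 - δ)) → HasDWaveOrder U μ → ∀ R : ℕ, 0 < R → ∀ ε : ℝ, 0 < ε → ∃ κ : ℝ, 0 < κ ∧ ∀ᶠ L : ℕ in Filter.atTop, -(ε * κ) * ((L + 1 : ℕ) : ℝ) ^ 2 ≤ (hubbardTorusWith 2 (L + 1) 1 U μ + (κ : ℂ) • (((((R : ℝ) ^ 4)⁻¹ : ℝ) : ℂ) • ∑ a : Literature.Probability.LatticeModels.TorusSite 2 (L + 1), (∑ u : Fin 2 → Fin R, localPair dWaveFormFactor (L + 1) (a + fun i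 => ((u i : ℕ) : ZMod (L + 1))))ᴴ * (∑ u : Fin 2 → Fin R, localPair dWaveFormFactor (L + 1) (a + fun i => ((u i : ℕ) : ZMod (L + 1)))))).groundEnergy + (hubbardTorusWith 2 (L + 1) 1 U μ + ((-κ : ℝ) : ℂ) • (((((R : ℝ) ^ 4)⁻¹ : ℝ) : ℂ) • ∑ a : Literature.Probability.LatticeModels.TorusSite 2 (L + 1), (∑ u : Fin 2 → Fin R, localPair dWaveFormFactor (L + 1) (a + fun i => ((u i : ℕ) : ZMod (L + 1))))ᴴ * (∑ u : Fin 2 → Fin R, localPair dWaveFormFactor (L + 1) (a + fun i => ((u i : ℕ) : ZMod (L + 1)))))).groundEnergy - 2 * (hubbardTorusWith 2 (L + 1) 1 U μ).groundEnergy) → Summit.HubbardSuperconductivity.HubbardSuperconductivity.Theses.KacWindowPenalty.WindowInfraredBound → Summit.HubbardSuperconductivity.HubbardSuperconductivity.Theses.ChiralWindow.CwSsbToEvenTorusLRO := by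
  intro hNK hW
  obtain ⟨U₀, hU₀, hNK⟩ := hNK
  refine ⟨U₀, hU₀, fun U hU δ hδ μ hdm hord => ?_⟩
  have hδ' : δ ∈ Set.Ioo (0:ℝ) 1 := ⟨hδ.1, by linarith [hδ.2]⟩
  exact hasDWavePairFieldLROAt_of_floor (floor_of_deriv_of_leak
    (deriv_of_chord (fp_chord_of_gcRepelledChordAt hδ' hdm (slopeFloor_of_noBlockKinkAt hord (hNK U hU δ hδ μ hdm hord))))
    (leak_of_windowInfraredBound hW hU.1 hδ))

/-- **The crux from NO SLOPE COLLAPSE (CONDITIONAL glue; the dimensionless filing).** The guarded statement "the repulsive block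
chord keeps a fraction `θ(U, μ) > 0` of the attractive one at some `κ(R) > 0`, every `R`" and stmt-1089 BY NAME imply the crux BY
NAME (`slopeFloor_of_noCollapseAt`, then as above). [folklore] -/
theorem cwSsbToEvenTorusLRO_of_noSlopeCollapse
    (hNC : ∃ U₀ : ℝ, 0 < U₀ ∧ ∀ U ∈ Set.Ioo (0:ℝ) U₀, ∀ δ ∈ Set.Ioo (0:ℝ) (1 / 2), ∀ μ : ℝ, Filter.Tendsto (fun L : ℕ => ((hubbardTorusWith 2 (L + 1) 1 U μ).groundStateFunctional totalNumber).re / ((L + 1 : ℕ) : ℝ) ^ 2) Filter.atTop (nhds (1 - δ)) → HasDWaveOrder U μ → ∃ θ : ℝ, 0 < θ ∧ ∀ R : ℕ, 0 < R → ∃ κ : ℝ, 0 < κ ∧ ∀ᶠ L : ℕ in Filter.atTop, θ * ((hubbardTorusWith 2 (L + 1) 1 U μ).groundEnergy - (hubbardTorusWith 2 (L + 1) 1 U μ + ((-κ : ℝ) : ℂ) • (((((R : ℝ) ^ 4)⁻¹ : ℝ) : ℂ) • ∑ a : Literature.Probability.LatticeModels.TorusSite 2 (L + 1), (∑ u : Fin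 2 → Fin R, localPair dWaveFormFactor (L + 1) (a + fun i => ((u i : ℕ) : ZMod (L + 1))))ᴴ * (∑ u : Fin 2 → Fin R, localPair dWaveFormFactor (L + 1) (a + fun i => ((u i : ℕ) : ZMod (L + 1)))))).groundEnergy) ≤ (hubbardTorusWith 2 (L + 1) 1 U μ + (κ : ℂ) • (((((R : ℝ) ^ 4)⁻¹ : ℝ) : ℂ) • ∑ a : Literature.Probability.LatticeModels.TorusSite 2 (L + 1), (∑ u : Fin 2 → Fin R, localPair dWaveFormFactor (L + 1) (a + fun i => ((u i : ℕ) : ZMod (L + 1))))ᴴ * (∑ u : Fin 2 → Fin R, localPair dWaveFormFactor (L + 1) (a + fun i => ((u i : ℕ) : ZMod (L + 1)))))).groundEnergy - (hubbardTorusWith 2 (L + 1) 1 U μ).groundEnergy)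
    (hW : Summit.HubbardSuperconductivity.HubbardSuperconductivity.Theses.KacWindowPenalty.WindowInfraredBound) :
    Summit.HubbardSuperconductivity.HubbardSuperconductivity.Theses.ChiralWindow.CwSsbToEvenTorusLRO := by
  obtain ⟨U₀, hU₀, hNC⟩ := hNC
  refine ⟨U₀, hU₀, fun U hU δ hδ μ hdm hord => ?_⟩
  have hδ' : δ ∈ Set.Ioo (0:ℝ) 1 := ⟨hδ.1, by linarith [hδ.2]⟩
  exact hasDWavePairFieldLROAt_of_floor (floor_of_deriv_of_leak
    (deriv_of_chord (fp_chord_of_gcRepelledChordAt hδ' hdm (slopeFloor_of_noCollapseAt hord (hNC U hU δ hδ μ hdm hord))))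
    (leak_of_windowInfraredBound hW hU.1 hδ))

end Summit.HubbardSuperconductivity.HubbardSuperconductivity.Theorems.CwSsbToEvenTorusLRO

end
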